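import Literature.AnabelianGeometry.EtaleTheta.Discharge.Sec2HuuEigenSplitting
import Literature.AnabelianGeometry.EtaleTheta.Discharge.Sec2ThetaSubquotientNormal
import HarnessLib

/-!
# [EtTh] §2 AT THE §1 MODEL, FROM A CHOSEN `X̲̲`: the cover `TemperedCoverData` whose `X̲̲`-member IS
# `C.Huu`, and abc-iut-L2-t2's `OrbitEmbedding` INHABITED (`map_Huu` as a theorem; census C10)

Mochizuki, *The étale theta function and its Frobenioid-theoretic manifestations*, Publ. RIMS **45**
(2009) [EtTh], §2: Def. 2.1 p. 36, Prop. 2.2 pp. 36–38, Def. 2.3 p. 38, Prop. 2.4 p. 38, Def. 2.5 (i)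
p. 39, Def. 2.7 p. 41 (PRIMS PDF pages, printed `+226`) [cite: MochizukiEtTh2009, Def 2.5 (i) p.39].

Cell abc-iut, layer L2, seat abc-iut-L2-d3 (gen 6), W3-L2-02 «§2 COVER/ORBIT MODEL», census item C10
(«`OrbitEmbedding.map_Huu` at the model»). Class (b) MODEL / CONSTRUCTION file over FROZEN interfaces
(abc-iut-L2-t2's `ThetaCovers.TemperedCoverData`, `DoubleUnderline.OrbitEmbedding`; abc-iut-L2-t8's
`EtaleThetaData.DoubleUnderline`, `IotaStable`, `CuspAdapted`); no interface clause touched; two `def`s.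

Gen 5's `CLevelData.temperedCoverData` (ThetaCoversTemperedOfSetting v2) assembles the §2 cover from a
chosen closed splitting `S` of `D̄_x ↠ G_K`, so its `X̲̲`-member is `Classical.choose`-n and abc-iut-L2-t2's
`OrbitEmbedding.map_Huu` ("`Π^tp_{X̲̲}` of `T` is the image of the chosen `Π^tp_{X̲̲} = C.Huu`") was
undecidable for it. THIS file assembles the cover FROM the choice `X̲̲ = C.Huu` the text makes (Def. 2.5 (i)),
on the proof-only companions `Sec2HuuClosureModel` / `Sec2HuuEigenSplitting` (`E := H ∩ Δ_C` IS the
`(−1)`-eigenspace, `S := H ∩ (D_x·Ker)` IS a splitting, `S·E = H`, `exists_inversion_ofHuu`):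

* **`CLevelData.temperedCoverDataOfHuu … : TemperedCoverData l`** — profinite part = abc-iut-L2-t10's
  `PiCData.coverDataAx`; `Π_{C̲̲} := H·⟨ι₀⟩` for the inversion `ι₀` of `exists_inversion_ofHuu`; tempered part
  as in gen 5 (`Π^tp_C := M.GtpC`, `toHat := ιC`, `Π^tp_Y := inclX(Ker toZ)`, `Π^tp_Ÿ := inclX(Π^tp_Ÿ)`,
  `Π^tp_Ċ := dotC ε_Z`); with **`temperedCoverDataOfHuu_PiXuu`** (`T.PiXuu = H`),
  **`temperedCoverDataOfHuu_tp_PiXuu`** (`T.tp T.PiXuu = inclX(C.Huu)` — THE `map_Huu` clause), `_PiXu`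
  (`T.PiXu = Π_X̲`), `_tp_PiXu`, `_PiYtp_le_tp_PiXu` (Def. 2.5 (i)(a)), `_aug_toHat_inclX`;
* **`CLevelData.orbitEmbeddingOfHuu … : C.OrbitEmbedding T`** — abc-iut-L2-t2's parameter bundle INHABITED
  at the model modulo the two points `τ^{±1}` (data), so that `ThetaOrbitData.ofEmbedding` (Def. 2.7 /
  Cor. 2.8 at the model, `ThetaRootOrbitsOfSetting`) applies; `nonempty_orbitEmbeddingOfHuu`.

HONEST RESIDUE (named binders; no new `Prop` fact): `op : OncePuncturedData` (abc-iut-L2-t7); P-C3 `hIx`;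
P-C4 `hιell`; P-C7 `hN`, `hY` (tempered normalities, L02); `hK : barKerTp l ≤ C.Huu` ("`Π^tp_{X̲̲} ⊇
Ker(Δ^tp_X ↠ Δ̄_X)`": `X̲̲ → X` lies over the `Δ̄_X`-level — print's `Π_{X̲̲} = S·E ⊇ E ⊇ Ker`, a clause of the
DATUM `X̲̲` not recorded by `DoubleUnderline`; GAP-LEDGER row of this seat); `C.IotaStable (e.conjX g)` and
`C.CuspAdapted x` (census C10 predicates); `τ, τ'` (Def. 1.9 points, data). The closed-splitting binder
`(S, hS, hSc)` of gen 5 is GONE (the splitting is DEFINED from `X̲̲`). Nothing asserts that a `MuTwoSetting`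
exists; [EtTh] is refereed; no side is taken on [IUTchIII] Cor. 3.12; typed ≠ proved.
-/

noncomputable section

namespace Literature.AnabelianGeometry.EtaleTheta

open Literature.AnabelianGeometry.SemiGraphs ThetaCovers
open _root_.Topology

namespace MuTwoSetting.CLevelData

variable {p : ℕ} [Fact p.Prime] {M : MuTwoSetting p}
variable {PC : Type} [Group PC] [TopologicalSpace PC] [IsTopologicalGroup PC] [T2Space PC]

/-! ### The assembly -/

/-- **An inhabitant of `TemperedCoverData l` at the [EtTh] §1 model whose `X̲̲`-member IS the chosen
`X̲̲ = C.Huu`** (Def. 2.3 / 2.5 (i)): profinite part = abc-iut-L2-t10's `PiCData.coverDataAx` over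
`I := e.piCDataOf ιC hιC`; `Π_{C̲̲} := cl(ιC(inclX(C.Huu)))·⟨ι₀⟩` for the inversion `ι₀` of
`exists_inversion_ofHuu`; tempered part as in gen 5's `temperedCoverData` (`Π^tp_C := M.GtpC`,
`toHat := ιC`, `Π^tp_Y := inclX(Ker toZ)`, `Π^tp_Ÿ := inclX(Π^tp_Ÿ)`, `Π^tp_Ċ := dotC ε_Z`). Binders: see the
module docstring. [cite: MochizukiEtTh2009, Def 2.5 (i) p.39] -/
def temperedCoverDataOfHuu (e : M.CLevelData) (ιC : M.GtpC →ₜ* PC) (hιC : IsProfiniteCompletion ιC)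
    (hinj : Function.Injective ιC) (op : M.toThetaSetting.OncePuncturedData) {l : ℕ} (hodd : Odd l)
    {x : M.Pt} (hx : M.IsCusp x)
    (hIx : ((e.piCDataOf ιC hιC).Dx x ⊓ (e.piCDataOf ιC hιC).augGK.ker) ⊔ (e.piCDataOf ιC hιC).barKer l =
      (e.piCDataOf ιC hιC).barTheta l)
    (hιell : ∀ c ∈ (e.piCDataOf ιC hιC).augGK.ker, c ∉ (e.piCDataOf ιC hιC).PiX →
      ∀ d ∈ (e.piCDataOf ιC hιC).PiX ⊓ (e.piCDataOf ιC hιC).augGK.ker,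
        c * d * c⁻¹ * d ∈ (e.piCDataOf ιC hιC).barTheta l)
    (hN : ((M.GtpXu l).map M.inclX).Normal) (hY : (M.GtpY.map M.inclX).Normal)
    {E : M.toThetaSetting.EtaleThetaData} (C : E.DoubleUnderline l) (hK : M.barKerTp l ≤ C.Huu)
    {g : M.GtpC} (hgX : g ∉ M.inclX.range) (hι : C.IotaStable (e.conjX g)) (hA : C.CuspAdapted x) :
    TemperedCoverData.{0} l :=
  { (e.piCDataOf ιC hιC).coverDataAx l op hx hodd hIx hιell
      ((e.piCDataOf ιC hιC).inv_theta_of_inv_ell l op hιell) with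
    PiCuu := ((C.Huu.map M.inclX).map ιC.toMonoidHom).topologicalClosure ⊔
      Subgroup.zpowers (Classical.choose (e.exists_inversion_ofHuu ιC hιC op hodd hx hIx hιell hN C hK hA hgX hι))
    isTypeLTorsThetaPm :=
      (Classical.choose_spec (e.exists_inversion_ofHuu ιC hιC op hodd hx hIx hιell hN C hK hA hgX hι)).1
    isOpen_PiCuu' := Subgroup.isOpen_mono le_sup_left (e.isOpen_closureHuu ιC hιC C)
    Gtp := M.GtpC
    toHat := ιC.toMonoidHom
    continuous_toHat := ιC.continuous
    injective_toHat := hinj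
    isProfiniteCompletion_toHat := hιC
    PiYtp := M.GtpY.map M.inclX
    PiYtp_le := map_inclX_GtpY_le ιC hιC _ (e.piCDataOf_incl_toHat ιC hιC)
    PiYtp_normal := hY
    isOpen_PiYtp := e.isOpen_map_inclX_GtpY
    quotZ := by
      haveI := hY
      exact nonempty_quot_map_inclX_GtpY_mulEquiv ιC hιC _ (e.piCDataOf_incl_toHat ιC hιC)
    PiYddtp := M.GtpYdd.map M.inclX
    PiYddtp_le := map_inclX_GtpYdd_le M
    isOpen_PiYddtp := e.isOpen_map_inclX_GtpYdd
    relIndex_PiYddtp := relIndex_map_inclX_GtpYdd M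
    PiCdot := M.dotC (Classical.choose M.exists_isAdmissibleEpsZ)
    index_PiCdot := M.index_dotC (Classical.choose_spec M.exists_isAdmissibleEpsZ)
    isOpen_PiCdot := e.isOpen_dotC _
    PiCdot_ne := dotC_ne_comap_range ιC hιC _ (e.piCDataOf_incl_toHat ιC hιC)
      (Classical.choose_spec M.exists_isAdmissibleEpsZ) }

section Identities

variable (e : M.CLevelData) (ιC : M.GtpC →ₜ* PC) (hιC : IsProfiniteCompletion ιC)
  (hinj : Function.Injective ιC) (op : M.toThetaSetting.OncePuncturedData) {l : ℕ} (hodd : Odd l)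
  {x : M.Pt} (hx : M.IsCusp x)
  (hIx : ((e.piCDataOf ιC hιC).Dx x ⊓ (e.piCDataOf ιC hιC).augGK.ker) ⊔ (e.piCDataOf ιC hιC).barKer l =
    (e.piCDataOf ιC hιC).barTheta l)
  (hιell : ∀ c ∈ (e.piCDataOf ιC hιC).augGK.ker, c ∉ (e.piCDataOf ιC hιC).PiX →
    ∀ d ∈ (e.piCDataOf ιC hιC).PiX ⊓ (e.piCDataOf ιC hιC).augGK.ker,
      c * d * c⁻¹ * d ∈ (e.piCDataOf ιC hιC).barTheta l)
  (hN : ((M.GtpXu l).map M.inclX).Normal) (hY : (M.GtpY.map M.inclX).Normal)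
  {E : M.toThetaSetting.EtaleThetaData} (C : E.DoubleUnderline l) (hK : M.barKerTp l ≤ C.Huu)
  {g : M.GtpC} (hgX : g ∉ M.inclX.range) (hι : C.IotaStable (e.conjX g)) (hA : C.CuspAdapted x)

/-- The underlying `CoverDataAx` of `temperedCoverDataOfHuu` IS abc-iut-L2-t10's `PiCData.coverDataAx`; its
`Π^tp_C`, `toHat`, `Π^tp_Y`, `Π^tp_Ÿ` are `M.GtpC`, `ιC`, `inclX(Π^tp_Y)`, `inclX(Π^tp_Ÿ)` (rfl bookkeeping).
[cite: MochizukiEtTh2009, Def 2.1 p.36] -/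
theorem temperedCoverDataOfHuu_toCoverDataAx :
    (e.temperedCoverDataOfHuu ιC hιC hinj op hodd hx hIx hιell hN hY C hK hgX hι hA).toCoverDataAx =
      (e.piCDataOf ιC hιC).coverDataAx l op hx hodd hIx hιell
        ((e.piCDataOf ιC hιC).inv_theta_of_inv_ell l op hιell) ∧
    (e.temperedCoverDataOfHuu ιC hιC hinj op hodd hx hIx hιell hN hY C hK hgX hι hA).Gtp = M.GtpC ∧
    (e.temperedCoverDataOfHuu ιC hιC hinj op hodd hx hIx hιell hN hY C hK hgX hι hA).toHat = ιC.toMonoidHom ∧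
    (e.temperedCoverDataOfHuu ιC hιC hinj op hodd hx hIx hιell hN hY C hK hgX hι hA).PiYtp = M.GtpY.map M.inclX ∧
    (e.temperedCoverDataOfHuu ιC hιC hinj op hodd hx hIx hιell hN hY C hK hgX hι hA).PiYddtp =
      M.GtpYdd.map M.inclX :=
  ⟨rfl, rfl, rfl, rfl, rfl⟩

/-- **`Π_{C̲̲}` of the assembled cover is `H·⟨ι₀⟩`** for an inversion `ι₀ ∈ Δ_C ∖ Π_X` with `ι₀² ∈ Ker`
normalising `H := cl(ιC(inclX(C.Huu)))`. [cite: MochizukiEtTh2009, Def 2.3 p.38] -/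
theorem temperedCoverDataOfHuu_PiCuu :
    ∃ ι₀ : PC, ι₀ ∈ (e.piCDataOf ιC hιC).augGK.ker ∧ ι₀ ∉ (e.piCDataOf ιC hιC).PiX ∧
      ι₀ * ι₀ ∈ (e.piCDataOf ιC hιC).barKer l ∧
      (∀ h ∈ ((C.Huu.map M.inclX).map ιC.toMonoidHom).topologicalClosure,
        ι₀ * h * ι₀⁻¹ ∈ ((C.Huu.map M.inclX).map ιC.toMonoidHom).topologicalClosure) ∧
      (e.temperedCoverDataOfHuu ιC hιC hinj op hodd hx hIx hιell hN hY C hK hgX hι hA).PiCuu =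
        ((C.Huu.map M.inclX).map ιC.toMonoidHom).topologicalClosure ⊔ Subgroup.zpowers ι₀ := by
  have h := Classical.choose_spec (e.exists_inversion_ofHuu ιC hιC op hodd hx hIx hιell hN C hK hA hgX hι)
  exact ⟨_, h.2.2.1, h.2.2.2.1, h.2.2.2.2.1, h.2.2.2.2.2, rfl⟩

/-- **`Π_{X̲̲}` of the assembled cover IS `H = cl(ιC(inclX(C.Huu)))`** (`T.PiXuu = Π_{C̲̲} ∩ Π_X = H`).
[cite: MochizukiEtTh2009, Def 2.3 p.38] -/
theorem temperedCoverDataOfHuu_PiXuu :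
    (e.temperedCoverDataOfHuu ιC hιC hinj op hodd hx hIx hιell hN hY C hK hgX hι hA).PiXuu =
      ((C.Huu.map M.inclX).map ιC.toMonoidHom).topologicalClosure :=
  (Classical.choose_spec (e.exists_inversion_ofHuu ιC hιC op hodd hx hIx hιell hN C hK hA hgX hι)).2.1

/-- **`OrbitEmbedding.map_Huu` AS A THEOREM at the model: `Π^tp_{X̲̲}` of the assembled cover IS
`inclX(C.Huu)`** — "`Π^tp_{X̲̲}` of `T` (pulled back to `Π^tp_C`) is the image of the chosen `Π^tp_{X̲̲} = C.Huu`"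
(census C10; `ιC⁻¹(cl(ιC(inclX(Huu)))) = inclX(Huu)` for the open finite-index `Huu`).
[cite: MochizukiEtTh2009, Def 2.5 (i) p.39] -/
theorem temperedCoverDataOfHuu_tp_PiXuu :
    (e.temperedCoverDataOfHuu ιC hιC hinj op hodd hx hIx hιell hN hY C hK hgX hι hA).tp
        (e.temperedCoverDataOfHuu ιC hιC hinj op hodd hx hIx hιell hN hY C hK hgX hι hA).PiXuu =
      C.Huu.map M.inclX := by
  rw [TemperedCoverData.tp, temperedCoverDataOfHuu_PiXuu]
  exact e.comap_closureHuu ιC hιC C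

/-- **`Π_X̲` of the assembled cover IS `cl(ιC(inclX(Π^tp_X̲)))`** (`T.PiXu = Π_{X̲̲}·Δ̄_Θ-preimage = H·Δ_X̲ = Π_X̲`).
[cite: MochizukiEtTh2009, Def 2.1 p.36] -/
theorem temperedCoverDataOfHuu_PiXu :
    (e.temperedCoverDataOfHuu ιC hιC hinj op hodd hx hIx hιell hN hY C hK hgX hι hA).PiXu =
      (((M.GtpXu l).map M.inclX).map ιC.toMonoidHom).topologicalClosure := by
  set I := e.piCDataOf ιC hιC with hI
  set H := ((C.Huu.map M.inclX).map ιC.toMonoidHom).topologicalClosure with hH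
  set Xu := (((M.GtpXu l).map M.inclX).map ιC.toMonoidHom).topologicalClosure with hXu
  haveI : NeZero l := ⟨by obtain ⟨k, hk⟩ := hodd; omega⟩
  rw [TemperedCoverData.PiXu, temperedCoverDataOfHuu_PiXuu]
  change H ⊔ I.barTheta l = Xu
  have hHXu : H ≤ Xu := closureHuu_le_closureXu ιC C
  refine le_antisymm (sup_le hHXu (e.barTheta_le_closureXu ιC hιC op l)) fun z hz => ?_
  obtain ⟨h, hh, d, hd, rfl⟩ := e.exists_closureHuu_mul_delta_eq ιC hιC C hz
  have hEc := e.isMinusEigen_ofHuu ιC hιC op hodd hx hIx hιell hN C hK ⊤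
    (Classical.choose_spec (e.exists_inversion_ofHuu ιC hιC op hodd hx hIx hιell hN C hK hA hgX hι)).2.2.1
    (Classical.choose_spec (e.exists_inversion_ofHuu ιC hιC op hodd hx hIx hιell hN C hK hA hgX hι)).2.2.2.1
    (fun e' he' => ⟨(Classical.choose_spec
        (e.exists_inversion_ofHuu ιC hιC op hodd hx hIx hιell hN C hK hA hgX hι)).2.2.2.2.2 e' he'.1,
      (MonoidHom.normal_ker _).conj_mem _ he'.2 _⟩)
  have hd' : d ∈ (H ⊓ I.augGK.ker) ⊔ I.barTheta l := hEc.sup_eq.ge hd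
  exact Subgroup.mul_mem _ (Subgroup.mem_sup_left hh)
    ((sup_le_sup_right (inf_le_left : H ⊓ I.augGK.ker ≤ H) _) hd')

/-- **`Π^tp_X̲` of the assembled cover IS `inclX(Π^tp_X̲)`**. [cite: MochizukiEtTh2009, Prop 2.4 p.38] -/
theorem temperedCoverDataOfHuu_tp_PiXu :
    (e.temperedCoverDataOfHuu ιC hιC hinj op hodd hx hIx hιell hN hY C hK hgX hι hA).tp
        (e.temperedCoverDataOfHuu ιC hιC hinj op hodd hx hIx hιell hN hY C hK hgX hι hA).PiXu =
      (M.GtpXu l).map M.inclX := by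
  haveI : NeZero l := ⟨by obtain ⟨k, hk⟩ := hodd; omega⟩
  haveI : (M.GtpXu l).FiniteIndex := ⟨by rw [M.index_GtpXu l]; exact NeZero.ne l⟩
  rw [TemperedCoverData.tp, temperedCoverDataOfHuu_PiXu]
  exact e.comap_closure_map_inclX ιC hιC _ (M.isOpen_GtpXu l)

/-- **Def. 2.5 (i)(a) HOLDS for the assembled cover**: `Π^tp_Y ≤ Π^tp_X̲`. [cite: MochizukiEtTh2009, Def 2.5(i) p.39] -/
theorem temperedCoverDataOfHuu_PiYtp_le_tp_PiXu :
    (e.temperedCoverDataOfHuu ιC hιC hinj op hodd hx hIx hιell hN hY C hK hgX hι hA).PiYtp ≤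
      (e.temperedCoverDataOfHuu ιC hιC hinj op hodd hx hIx hιell hN hY C hK hgX hι hA).tp
        (e.temperedCoverDataOfHuu ιC hιC hinj op hodd hx hIx hιell hN hY C hK hgX hι hA).PiXu := by
  rw [temperedCoverDataOfHuu_tp_PiXu]
  exact Subgroup.map_mono (M.GtpY_le_GtpXu l)

/-- The composite augmentation `Π^tp_X → Π^tp_C → Π_C → G_K` of the assembled cover is the §1 augmentation
(abc-iut-L2-t2's `OrbitEmbedding.aug_ι` with `gk := MulEquiv.refl`). [cite: MochizukiEtTh2009, Def 2.1 p.36] -/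
theorem temperedCoverDataOfHuu_aug_toHat_inclX (z : M.PiTemp) :
    (e.temperedCoverDataOfHuu ιC hιC hinj op hodd hx hIx hιell hN hY C hK hgX hι hA).aug
        ((e.temperedCoverDataOfHuu ιC hιC hinj op hodd hx hIx hιell hN hY C hK hgX hι hA).toHat (M.inclX z)) =
      (MulEquiv.refl ↥M.GK) ⟨M.aug z, M.aug_mem_GK z⟩ := by
  apply Subtype.ext
  show (((e.piCDataOf ιC hιC).augGK (ιC (M.inclX z)) : M.GK) : GQp p) = M.aug z
  rw [ThetaSetting.PiCData.coe_augGK_apply, e.piCDataOf_aug_inclX]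

/-! ### abc-iut-L2-t2's `OrbitEmbedding` INHABITED at the model -/

/-- **An `OrbitEmbedding` of the chosen `X̲̲` into the assembled cover** (Def. 2.7 at the §1 model):
`ι := inclX` (injective), `ι(Π^tp_Ÿ) = T.PiYddtp` (rfl), **`ι(Π^tp_{X̲̲}) = Π^tp_{X̲̲}` of `T`**
(`temperedCoverDataOfHuu_tp_PiXuu`), normality in `Π^tp_C` of `ι(toTheta⁻¹ Δ_Θ)` and `ι(Ker toTheta)`
(gen 4, `Sec2ThetaSubquotientNormal`), `G_K = T.GK` (`MulEquiv.refl`) compatibly with the augmentations,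
and the two points `τ^{±1}` of Def. 1.9 as DATA. [cite: MochizukiEtTh2009, Def 2.7 p.41] -/
def orbitEmbeddingOfHuu (τ τ' : ThetaSetting.NonCuspidalPoint E.toKummerData) :
    C.OrbitEmbedding (e.temperedCoverDataOfHuu ιC hιC hinj op hodd hx hIx hιell hN hY C hK hgX hι hA) where
  ι := M.inclX
  injective_ι := M.injective_inclX
  map_GtpYdd := rfl
  map_Huu := (e.temperedCoverDataOfHuu_tp_PiXuu ιC hιC hinj op hodd hx hIx hιell hN hY C hK hgX hι hA).symm
  normal_top := e.map_inclX_comap_deltaTheta_normal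
  normal_bot := e.map_inclX_ker_toTheta_normal
  gk := MulEquiv.refl _
  aug_ι := e.temperedCoverDataOfHuu_aug_toHat_inclX ιC hιC hinj op hodd hx hIx hιell hN hY C hK hgX hι hA
  tau := τ
  tauInv := τ'

/-- **abc-iut-L2-t2's `OrbitEmbedding C T` is INHABITED at the [EtTh] §1 model** for the cover assembled from
the chosen `X̲̲ = C.Huu`, modulo the named binders of `temperedCoverDataOfHuu` and two non-cuspidal points
`τ^{±1}` (Def. 1.9). [cite: MochizukiEtTh2009, Def 2.7 p.41] -/
theorem nonempty_orbitEmbeddingOfHuu (τ τ' : ThetaSetting.NonCuspidalPoint E.toKummerData) :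
    Nonempty (C.OrbitEmbedding (e.temperedCoverDataOfHuu ιC hιC hinj op hodd hx hIx hιell hN hY C hK hgX hι hA)) :=
  ⟨e.orbitEmbeddingOfHuu ιC hιC hinj op hodd hx hIx hιell hN hY C hK hgX hι hA τ τ'⟩

end Identities

end MuTwoSetting.CLevelData

end Literature.AnabelianGeometry.EtaleTheta

end
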